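import Mathlib
import Literature.AlgebraicGeometry.Resolution.PointBlowupFlagInvariant
import Literature.AlgebraicGeometry.Resolution.PointBlowupHeightVectorDrops
import Summits.ResolutionOfSingularities.ResolutionOfSingularities.Theorems.WeightedInvariantLocalWeightedDropInsepNewtonMeasures
import Summits.ResolutionOfSingularities.ResolutionOfSingularities.Theorems.WeightedInvariantLocalWeightedDropInsepNewtonVMove

/-!
# `WeightedInvariant.LocalWeightedDrop`, line `hasse-ridge-face-selection`: Hauser–Wagner's move (V) lowers the height —
# `height(A′) + 1 ≤ height(A)` for the vertical successor, in given coordinates (unit M2 of the S2iM attack plan)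

Crux item stmt-ResolutionOfSingularities-8899 `LocalWeightedDrop` (route `ResolutionOfSingularities/WeightedInvariant`),
serving the door `WeightedConstruction` stmt-ResolutionOfSingularities-0571.  [OURS · L1 W4.3, chain w43, stub worker 3
(gen 2): unit M2 of L/res-L1-w43-stub-3/S2iM-ATTACK-PLAN.md; the mathematics is the «one-line computation» of
Hauser–Wagner, L'Enseignement Math. 60 (2014) p. 205, move (V), here for the typed measures
`HauserWagner2014.heightPS / degAlongPS / ordVarPS` and the lift's vertical successor; NOT a statement of any manuscript.]

Orientation free `= 0`, rigid `= 1`; `π_V^* A = X₀² A′` with `π_V : x₀ ↦ c₀X₀, x₁ ↦ X₀X₁`, `c₀ ≠ 0`, `A ≠ 0` of order `≥ 2`.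
* `degAlongPS_vSucc`: `α₁(A′) + 2 = α₁(A) + β₁(A)` (the highest vertex moves by `(α, β) ↦ (α + β − 2, β)`);
* `ordVarPS_vSucc_zero`: `ord_y(A′) + 2 = ord(A)` (the total order);
* `order_gt_of_heightPS_pos`: `height(A) > 0 ⇒ ord_y(A) + ord_z(A) < ord(A)` (else the Newton polygon is a quadrant);
* `heightPS_vSucc_succ_le`: **`height(A′) + 1 ≤ height(A)`** whenever `height(A) > 0`.
-/

set_option linter.dupNamespace false -- mandated namespace of this single-conjunct summit

namespace Summit.ResolutionOfSingularities.ResolutionOfSingularities.Theorems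

namespace InsepNewton

open MvPowerSeries
open Literature.AlgebraicGeometry.Resolution
open Literature.AlgebraicGeometry.Resolution.HauserPerlega2024 (ordAlong)
open Literature.AlgebraicGeometry.Resolution.HauserWagner2014 (ordVarPS degAlongPS heightPS)

variable {K : Type} [Field K]

/-- Evaluating a two-letter exponent `(a, b)` at the free slot. -/
theorem pair_apply_zero (a b : ℕ) : (Finsupp.single (0 : Fin 2) a + Finsupp.single 1 b : Fin 2 →₀ ℕ) 0 = a := by
  rw [Finsupp.add_apply, Finsupp.single_eq_same, Finsupp.single_eq_of_ne (zero_ne_one : (0 : Fin 2) ≠ 1), add_zero]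

/-- Evaluating a two-letter exponent `(a, b)` at the rigid slot. -/
theorem pair_apply_one (a b : ℕ) : (Finsupp.single (0 : Fin 2) a + Finsupp.single 1 b : Fin 2 →₀ ℕ) 1 = b := by
  rw [Finsupp.add_apply, Finsupp.single_eq_same, Finsupp.single_eq_of_ne (one_ne_zero : (1 : Fin 2) ≠ 0), zero_add]

/-- The degree of a two-letter exponent `(a, b)` is `a + b`. -/
theorem degree_pair (a b : ℕ) : (Finsupp.single (0 : Fin 2) a + Finsupp.single 1 b : Fin 2 →₀ ℕ).degree = a + b := by
  rw [map_add, Finsupp.degree_single, Finsupp.degree_single]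

/-- The vertical successor of a non-zero `A` of order `≥ 2` is non-zero. -/
theorem vSucc_ne_zero {c₀ : K} (hc₀ : c₀ ≠ 0) {A A' : MvPowerSeries (Fin 2) K} (hA : A ≠ 0) (hA2 : (2 : ℕ∞) ≤ A.order)
    (hfac : subst (fun l : Fin 2 => if l = 0 then C c₀ * X 0 else (X 0 * X 1 : MvPowerSeries (Fin 2) K)) A = X 0 ^ 2 * A') :
    A' ≠ 0 := by
  obtain ⟨d, hd', -⟩ := exists_coeff_apply_eq_ordVarPS 1 hA
  have hd := coeff_single_add_single_ne_zero hd'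
  have h := coeff_vSucc_ne_zero_of hc₀ hfac (two_le_add_of_coeff_ne_zero hA2 hd) hd
  rintro rfl
  exact h (map_zero _)

/-- THE HIGHEST VERTEX UNDER (V): `α₁(A′) + 2 = α₁(A) + β₁(A)`. -/
theorem degAlongPS_vSucc {c₀ : K} (hc₀ : c₀ ≠ 0) {A A' : MvPowerSeries (Fin 2) K} (hA : A ≠ 0)
    (hA2 : (2 : ℕ∞) ≤ A.order)
    (hfac : subst (fun l : Fin 2 => if l = 0 then C c₀ * X 0 else (X 0 * X 1 : MvPowerSeries (Fin 2) K)) A = X 0 ^ 2 * A') :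
    degAlongPS A' 1 0 + 2 = degAlongPS A 1 0 + ordVarPS A 1 := by
  have hA' := vSucc_ne_zero hc₀ hA hA2 hfac
  have hrig := ordVarPS_vSucc_one hc₀ hA hA2 hfac
  refine le_antisymm ?_ ?_
  · -- the vertex of `A` transported
    obtain ⟨d, hd', hd1, hd0⟩ := exists_vertex hA 1 0
    have hd := coeff_single_add_single_ne_zero hd'
    have h2 := two_le_add_of_coeff_ne_zero hA2 hd
    have h := coeff_vSucc_ne_zero_of hc₀ hfac h2 hd
    have hle := degAlongPS_le (rig := 1) (free := 0) h (by rw [pair_apply_one, hrig, hd1])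
    rw [pair_apply_zero] at hle
    rw [← hd0, ← hd1]
    omega
  · -- the vertex of `A′` transported back
    obtain ⟨e, he', he1, he0⟩ := exists_vertex hA' 1 0
    have he := coeff_single_add_single_ne_zero he'
    obtain ⟨hb, h⟩ := (coeff_vSucc_ne_zero_iff hc₀ hfac (e 0) (e 1)).mp he
    have hle := degAlongPS_le (rig := 1) (free := 0) h (by rw [pair_apply_one, he1, hrig])
    rw [pair_apply_zero] at hle
    rw [← he0, ← hrig, ← he1]
    omega

/-- THE FREE ORDER UNDER (V): `ord_y(A′) + 2 = ord(A)`. -/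
theorem ordVarPS_vSucc_zero {c₀ : K} (hc₀ : c₀ ≠ 0) {A A' : MvPowerSeries (Fin 2) K} (hA : A ≠ 0)
    (hA2 : (2 : ℕ∞) ≤ A.order)
    (hfac : subst (fun l : Fin 2 => if l = 0 then C c₀ * X 0 else (X 0 * X 1 : MvPowerSeries (Fin 2) K)) A = X 0 ^ 2 * A') :
    ((ordVarPS A' 0 + 2 : ℕ) : ℕ∞) = A.order := by
  have hA' := vSucc_ne_zero hc₀ hA hA2 hfac
  refine le_antisymm ?_ ?_
  · -- a support point of `A` of minimal degree, transported
    obtain ⟨d, hd', hdeg⟩ := exists_coeff_ne_zero_and_order ((ne_zero_iff_order_finite (f := A)).mp hA)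
    have hd := coeff_single_add_single_ne_zero hd'
    have h2 := two_le_add_of_coeff_ne_zero hA2 hd
    have h := coeff_vSucc_ne_zero_of hc₀ hfac h2 hd
    have hle := ordVarPS_le 0 h
    rw [pair_apply_zero] at hle
    have hdeg' : (d.degree : ℕ∞) = ((d 0 + d 1 : ℕ) : ℕ∞) := by
      conv_lhs => rw [show d = Finsupp.single 0 (d 0) + Finsupp.single 1 (d 1) by
        ext l; rcases (by fin_cases l <;> simp : l = 0 ∨ l = 1) with rfl | rfl <;> simp]
      rw [degree_pair]
    rw [← hdeg, hdeg']
    exact_mod_cast (by omega : ordVarPS A' 0 + 2 ≤ d 0 + d 1)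
  · -- a support point of `A′` on the column `ord_y(A′)`, transported back
    obtain ⟨e, he', he0⟩ := exists_coeff_apply_eq_ordVarPS 0 hA'
    have he := coeff_single_add_single_ne_zero he'
    obtain ⟨hb, h⟩ := (coeff_vSucc_ne_zero_iff hc₀ hfac (e 0) (e 1)).mp he
    have hle := order_le h
    rw [degree_pair] at hle
    refine le_trans hle ?_
    rw [← he0]
    exact_mod_cast (by omega : e 0 + 2 - e 1 + e 1 ≤ e 0 + 2)

/-- POSITIVE HEIGHT FORCES `ord_y + ord_z < ord`: otherwise the point `(ord_y, ord_z)` is in the support and the Newton polygon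
is a quadrant. -/
theorem order_gt_of_heightPS_pos {A : MvPowerSeries (Fin 2) K} (hA : A ≠ 0) (h : 0 < heightPS A 1 0) :
    ((ordVarPS A 0 + ordVarPS A 1 : ℕ) : ℕ∞) < A.order := by
  by_contra hle
  rw [not_lt] at hle
  -- a support point of minimal degree has both exponents minimal
  obtain ⟨d, hd', hdeg⟩ := exists_coeff_ne_zero_and_order ((ne_zero_iff_order_finite (f := A)).mp hA)
  have hd := coeff_single_add_single_ne_zero hd'
  have h0 := ordVarPS_le 0 hd
  have h1 := ordVarPS_le 1 hd
  rw [pair_apply_zero] at h0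
  rw [pair_apply_one] at h1
  have hdeg' : (d.degree : ℕ∞) = ((d 0 + d 1 : ℕ) : ℕ∞) := by
    conv_lhs => rw [show d = Finsupp.single 0 (d 0) + Finsupp.single 1 (d 1) by
      ext l; rcases (by fin_cases l <;> simp : l = 0 ∨ l = 1) with rfl | rfl <;> simp]
    rw [degree_pair]
  rw [← hdeg, hdeg'] at hle
  have hsum : d 0 + d 1 ≤ ordVarPS A 0 + ordVarPS A 1 := by exact_mod_cast hle
  have hd0 : d 0 = ordVarPS A 0 := by omega
  have hd1 : d 1 = ordVarPS A 1 := by omega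
  -- hence `α₁ ≤ ord_y`, i.e. height `0`
  have hα := degAlongPS_le (rig := 1) (free := 0) hd (by rw [pair_apply_one, hd1])
  rw [pair_apply_zero, hd0] at hα
  rw [heightPS] at h
  omega

/-- **HAUSER–WAGNER, MOVE (V): THE HEIGHT DROPS** — `height(A′) + 1 ≤ height(A)` for the vertical successor of a position of
positive height (given coordinates, free `= 0`, rigid `= 1`; `A ≠ 0` of order `≥ 2`, `c₀ ≠ 0`). [cite: HauserWagner2014, §6.1 (V) p. 205] -/
theorem heightPS_vSucc_succ_le {c₀ : K} (hc₀ : c₀ ≠ 0) {A A' : MvPowerSeries (Fin 2) K} (hA : A ≠ 0)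
    (hA2 : (2 : ℕ∞) ≤ A.order)
    (hfac : subst (fun l : Fin 2 => if l = 0 then C c₀ * X 0 else (X 0 * X 1 : MvPowerSeries (Fin 2) K)) A = X 0 ^ 2 * A')
    (h : 0 < heightPS A 1 0) :
    heightPS A' 1 0 + 1 ≤ heightPS A 1 0 := by
  have hdeg := degAlongPS_vSucc hc₀ hA hA2 hfac
  have hordy := ordVarPS_vSucc_zero hc₀ hA hA2 hfac
  have hgt := order_gt_of_heightPS_pos hA h
  rw [← hordy] at hgt
  have hgt' : ordVarPS A 0 + ordVarPS A 1 < ordVarPS A' 0 + 2 := by exact_mod_cast hgt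
  have hle := ordVarPS_le_degAlongPS hA 1 0
  rw [heightPS, heightPS] at *
  omega

end InsepNewton

end Summit.ResolutionOfSingularities.ResolutionOfSingularities.Theorems
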